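import Literature.Computability.Cryptography.QuantumCircuit
import HarnessLib

/-!
# The XOR oracle gate on basis states and phase kick-back (trunk `CryptoQuantFine`)

The action of a *placed* oracle query `placeGate e (oracleGate A k)` (query wires
`e 0, …, e (k-1)`, answer wire `e k`; `QuantumCircuit.lean`) on state vectors:

* `placeGate_oracleGate_mulVec_apply` — on an arbitrary state vector `ψ` the gate permutes
  amplitudes: the amplitude of `|x⟩` after the gate is the amplitude, before, of `x` with its
  answer bit flipped iff the query string of `x` lies in `A`
  (`|q, b, rest⟩ ↦ |q, b ⊕ [q ∈ A], rest⟩`, Nielsen–Chuang 2010, §6.1.1, Eq. (6.2));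
* `placeGate_oracleGate_mulVec_basisState` — the basis-state form;
* `placeGate_oracleGate_mulVec_of_isMinusOn` — **phase kick-back**: if the answer wire carries
  `|−⟩` (the state vector is odd under flipping that wire, `IsMinusOn`), the gate multiplies the
  amplitude of `|x⟩` by `(−1)^{[q(x) ∈ A]}` (Nielsen–Chuang 2010, §6.1.1, Eq. (6.4):
  `|x⟩(|0⟩−|1⟩)/√2 ↦ (−1)^{f(x)} |x⟩(|0⟩−|1⟩)/√2`; Bernstein–Vazirani 1997, §8).

These are the two facts about oracle gates used by every `BQP^A` algorithm in the tree's model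
(`BQPRel`): queries in superposition are phase queries once the answer wire is prepared in `|−⟩`
(e.g. the one-query Forrelation algorithm of Raz–Tal, App. A / §6, `RazTal2022_bqpMachine`).

## References

* M. A. Nielsen, I. L. Chuang, *Quantum Computation and Quantum Information* (2010), §6.1.1,
  Eqs. (6.2), (6.4).
* E. Bernstein, U. Vazirani, *Quantum complexity theory*, SIAM J. Comput. 26 (1997), §8.
-/

namespace Literature.Computability.Cryptography

open Matrix

variable {k N : ℕ}

/-- The query string of the basis label `x` read off the query wires `e 0, …, e (k-1)` of a placed
oracle gate (`List.ofFn`, as in `oracleGate`). [cite: NielsenChuang2010, §6.1.1] -/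
def queryOf (e : Fin (k + 1) ↪ Fin N) (x : QReg N) : List Bool :=
  List.ofFn fun i : Fin k => x (e i.castSucc)

/-- The basis label reached from `x` by the placed oracle gate: the answer wire `e k` is XORed with
`[q(x) ∈ A]`. [cite: NielsenChuang2010, §6.1.1 Eq. (6.2)] -/
noncomputable def oracleTarget (A : Language Bool) (e : Fin (k + 1) ↪ Fin N) (x : QReg N) : QReg N :=
  Function.update x (e (Fin.last k)) (x (e (Fin.last k)) ^^ A.boolIndicator (queryOf e x))

/-- The answer wire is not a query wire. [folklore] -/
theorem castSucc_ne_last_wire (e : Fin (k + 1) ↪ Fin N) (i : Fin k) :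
    e i.castSucc ≠ e (Fin.last k) := fun h =>
  (Fin.castSucc_lt_last i).ne (e.injective h)

/-- `oracleTarget` keeps the query wires. [folklore] -/
theorem oracleTarget_apply_castSucc (A : Language Bool) (e : Fin (k + 1) ↪ Fin N) (x : QReg N)
    (i : Fin k) : oracleTarget A e x (e i.castSucc) = x (e i.castSucc) := by
  unfold oracleTarget
  rw [Function.update_of_ne (castSucc_ne_last_wire e i)]

/-- `oracleTarget` keeps every wire off the gate. [folklore] -/
theorem oracleTarget_apply_of_notMem (A : Language Bool) (e : Fin (k + 1) ↪ Fin N) (x : QReg N)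
    {i : Fin N} (hi : i ∉ Set.range e) : oracleTarget A e x i = x i := by
  unfold oracleTarget
  rw [Function.update_of_ne]
  rintro rfl
  exact hi ⟨_, rfl⟩

/-- `oracleTarget` is an involution (XOR twice). [folklore] -/
theorem oracleTarget_oracleTarget (A : Language Bool) (e : Fin (k + 1) ↪ Fin N) (x : QReg N) :
    oracleTarget A e (oracleTarget A e x) = x := by
  have hq : queryOf e (oracleTarget A e x) = queryOf e x := by
    unfold queryOf
    exact List.ofFn_inj.2 (funext fun i => oracleTarget_apply_castSucc A e x i)
  unfold oracleTarget
  rw [show queryOf e (Function.update x (e (Fin.last k))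
      (x (e (Fin.last k)) ^^ A.boolIndicator (queryOf e x))) = queryOf e x from hq]
  simp only [Function.update_self, Function.update_idem]
  rw [Bool.xor_assoc, Bool.xor_self, Bool.xor_false, Function.update_eq_self]

/-- On the gate's own wires `oracleTarget` is the tree's `oracleFlip` of `QuantumCircuit.lean`
(the unplaced XOR map on `{0,1}^{k+1}`). [cite: NielsenChuang2010, §6.1.1 Eq. (6.2)] -/
theorem oracleTarget_comp_eq_oracleFlip (A : Language Bool) (e : Fin (k + 1) ↪ Fin N) (x : QReg N) :
    (fun i => oracleTarget A e x (e i)) = oracleFlip A k (fun i => x (e i)) := by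
  funext i
  induction i using Fin.lastCases with
  | last =>
    rw [oracleFlip_last]
    unfold oracleTarget queryOf
    rw [Function.update_self]
  | cast i => rw [oracleFlip_castSucc, oracleTarget_apply_castSucc]

/-- **The entries of a placed oracle gate**: `⟨x| U_A |y⟩ = [y = oracleTarget x]`. [cite: NielsenChuang2010, §6.1.1 Eq. (6.2)] -/
theorem placeGate_oracleGate_apply (A : Language Bool) (e : Fin (k + 1) ↪ Fin N) (x y : QReg N) :
    placeGate e (oracleGate A k) x y = if y = oracleTarget A e x then 1 else 0 := by
  rw [placeGate_apply]
  unfold oracleGate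
  simp only [Matrix.of_apply, Function.comp_apply]
  by_cases hy : y = oracleTarget A e x
  · subst hy
    rw [if_pos (fun i hi => (oracleTarget_apply_of_notMem A e x hi).symm), if_pos rfl, if_pos]
    refine ⟨fun i => (oracleTarget_apply_castSucc A e x i).symm, ?_⟩
    have hq : (List.ofFn fun i : Fin k => oracleTarget A e x (e i.castSucc)) = queryOf e x := by
      unfold queryOf
      exact List.ofFn_inj.2 (funext fun i => oracleTarget_apply_castSucc A e x i)
    rw [hq]
    unfold oracleTarget
    rw [Function.update_self, Bool.xor_assoc, Bool.xor_self, Bool.xor_false]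
  · rw [if_neg hy]
    split_ifs with h1 h2
    · exfalso
      apply hy
      funext i
      by_cases hi : i ∈ Set.range e
      · obtain ⟨j, rfl⟩ := hi
        rcases Fin.eq_castSucc_or_eq_last j with ⟨j, rfl⟩ | rfl
        · rw [oracleTarget_apply_castSucc]; exact (h2.1 j).symm
        · have hq : (List.ofFn fun i : Fin k => y (e i.castSucc)) = queryOf e x := by
            unfold queryOf
            exact List.ofFn_inj.2 (funext fun i => (h2.1 i).symm)
          have h3 := h2.2
          rw [hq] at h3
          unfold oracleTarget
          rw [Function.update_self, h3, Bool.xor_assoc, Bool.xor_self, Bool.xor_false]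
      · rw [oracleTarget_apply_of_notMem A e x hi]; exact (h1 i hi).symm
    · rfl
    · rfl

/-- **A placed oracle gate permutes amplitudes**: `(U_A ψ)(x) = ψ(oracleTarget x)`. [cite: NielsenChuang2010, §6.1.1 Eq. (6.2)] -/
theorem placeGate_oracleGate_mulVec_apply (A : Language Bool) (e : Fin (k + 1) ↪ Fin N)
    (ψ : QReg N → ℂ) (x : QReg N) :
    (placeGate e (oracleGate A k) *ᵥ ψ) x = ψ (oracleTarget A e x) := by
  simp only [Matrix.mulVec, dotProduct, placeGate_oracleGate_apply]
  simp [Finset.sum_ite_eq']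

/-- **The oracle gate on a basis state**: `U_A |x⟩ = |oracleTarget x⟩`
(`|q, b, rest⟩ ↦ |q, b ⊕ [q ∈ A], rest⟩`). [cite: NielsenChuang2010, §6.1.1 Eq. (6.2)] -/
theorem placeGate_oracleGate_mulVec_basisState (A : Language Bool) (e : Fin (k + 1) ↪ Fin N)
    (x : QReg N) :
    placeGate e (oracleGate A k) *ᵥ basisState x = basisState (oracleTarget A e x) := by
  funext y
  rw [placeGate_oracleGate_mulVec_apply, basisState_apply, basisState_apply]
  by_cases h : y = oracleTarget A e x
  · subst h
    rw [oracleTarget_oracleTarget, if_pos rfl, if_pos rfl]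
  · rw [if_neg h, if_neg]
    intro h'
    exact h (by rw [← h', oracleTarget_oracleTarget])

/-- The state vector `ψ` carries `|−⟩` on wire `t` (up to entanglement with the other wires): it
is odd under flipping wire `t`. [cite: NielsenChuang2010, §6.1.1 Eq. (6.4)] -/
def IsMinusOn (t : Fin N) (ψ : QReg N → ℂ) : Prop :=
  ∀ w : QReg N, ψ (Function.update w t true) = -ψ (Function.update w t false)

/-- Flipping the `|−⟩` wire changes the sign. [folklore] -/
theorem IsMinusOn.apply_update_not {t : Fin N} {ψ : QReg N → ℂ} (h : IsMinusOn t ψ)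
    (w : QReg N) : ψ (Function.update w t (!w t)) = -ψ w := by
  cases hw : w t
  · have := h w
    rw [show Function.update w t false = w by rw [← hw, Function.update_eq_self]] at this
    simpa using this
  · have := h w
    rw [show Function.update w t true = w by rw [← hw, Function.update_eq_self]] at this
    simp only [Bool.not_true]
    rw [this, neg_neg]

/-- **Phase kick-back**: with the answer wire in `|−⟩`, the oracle gate is the phase oracle
`|x⟩ ↦ (−1)^{[q(x) ∈ A]} |x⟩` (Nielsen–Chuang 2010, Eq. (6.4); Bernstein–Vazirani 1997, §8).
[cite: NielsenChuang2010, §6.1.1 Eq. (6.4)] -/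
theorem placeGate_oracleGate_mulVec_of_isMinusOn (A : Language Bool) (e : Fin (k + 1) ↪ Fin N)
    {ψ : QReg N → ℂ} (h : IsMinusOn (e (Fin.last k)) ψ) :
    placeGate e (oracleGate A k) *ᵥ ψ =
      fun x => (if A.boolIndicator (queryOf e x) then -1 else 1) * ψ x := by
  funext x
  rw [placeGate_oracleGate_mulVec_apply]
  unfold oracleTarget
  cases hq : A.boolIndicator (queryOf e x)
  · rw [Bool.xor_false, Function.update_eq_self]
    simp
  · rw [Bool.xor_true, h.apply_update_not]
    simp

/-- Phase kick-back preserves the `|−⟩` wire (so several queries can share one answer wire). [cite: NielsenChuang2010, §6.1.1] -/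
theorem IsMinusOn.placeGate_oracleGate (A : Language Bool) (e : Fin (k + 1) ↪ Fin N)
    {ψ : QReg N → ℂ} (h : IsMinusOn (e (Fin.last k)) ψ) :
    IsMinusOn (e (Fin.last k)) (placeGate e (oracleGate A k) *ᵥ ψ) := by
  intro w
  rw [placeGate_oracleGate_mulVec_of_isMinusOn A e h]
  have hq : queryOf e (Function.update w (e (Fin.last k)) true) =
      queryOf e (Function.update w (e (Fin.last k)) false) := by
    unfold queryOf
    refine List.ofFn_inj.2 (funext fun i => ?_)
    rw [Function.update_of_ne (castSucc_ne_last_wire e i), Function.update_of_ne (castSucc_ne_last_wire e i)]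
  show (if A.boolIndicator (queryOf e (Function.update w (e (Fin.last k)) true)) then -1 else 1) *
      ψ (Function.update w (e (Fin.last k)) true) =
    -((if A.boolIndicator (queryOf e (Function.update w (e (Fin.last k)) false)) then -1 else 1) *
      ψ (Function.update w (e (Fin.last k)) false))
  rw [hq, h w]
  ring

end Literature.Computability.Cryptography
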